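import Mathlib
import HarnessLib
import HarnessLib.Audit
import Summits.HodgeConjecture.HodgeConjecture.Statement
import Literature.AlgebraicGeometry.Motives.Sweep1
import Literature.AlgebraicGeometry.Motives.Cycles
import Literature.AlgebraicGeometry.HodgeTheory.HodgeConjecture
import Literature.AlgebraicGeometry.HodgeTheory.AlgebraicClasses

/-!
Route: ConiveauLadderCubicEightfolds

CLOSED (retired) 2026-08-15T13:48:11Z by operator:999:1257524 — reason: not-a-thesis: assembly does not conclude the sub-problem Statement — note: D-0027 §2.1 audit (human 2026-08-15: routes that do not decide the summit are removed): the assembly concludes `HodgeCubicEightfolds`, not the sub-problem statement; a NEW conforming route may be opened from the same idea (generated `closes : … → _root_.HodgeConjecture`).. The file is kept as the record of this route; refuted decls are indexed as negative knowledge (`ledger negatives`).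

Thesis X (idea card HodgeConjecture/HodgeConjecture/coniveau-ladder-cubic-eightfolds): the Hodge
conjecture holds for EVERY smooth cubic eightfold Y ⊂ ℙ⁹_ℂ — decl `HodgeCubicEightfolds : ∀ Y,
IsSmoothHypersurface 8 3 Y → HodgeConjectureFor 8 Y`. X is an INSTANCE FAMILY of the summit
statement: `HodgeConjecture → X` is the one-liner `fun h Y hY ↦ h hY.1` (checked in the planner's
Sketch.lean); `X → HodgeConjecture` is NOT claimed. This is a partial-result route in the sense of
PROBLEMS.md §3 ("Hodge for classes of varieties"): cubic eightfolds would be the first deformation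
class of hypersurfaces beyond fourfolds with HC known for all smooth members (generic members:
Terasoma1990).
It suffices to show (two layers; cruxes first, glue later): (1) for a coefficient-generic smooth
cubic eightfold Y = V(F) (the 220 coefficients of F algebraically independent over ℚ — a rigorous
'very general') CH₂(Y)⊗ℚ has rank ≤ 1 [crux rank 2 GenericCubicEightfoldChowTwo: Bai2024VoisinMaps
Thm 3.6 ∘ Mboro2018 Thm 0.2], ranks of CH₀, CH₁ ⊗ ℚ being ≤ 1 for every smooth Y [support
CubicEightfoldChowZeroOne]; (2) hence, by the Paranjape–Laterveer decomposition mΔ_Y = Z₀+Z₁+Z₂+Z′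
at the generic member (VoisinHodgeII2003 Thm 10.29 with k₀ = 2: Z_i ⊂ W′_i × W_i, dim W_i = i; Z′ ⊂
T × Y, codim T ≥ 3), spread over the universal family and specialised with its support shape to
every smooth member (Fulton1998 §20.3), where Z_i acts by 0 on H⁸ and Z′ acts into classes supported
on T: N³H⁸(Y(ℂ);ℂ) = H⁸ for EVERY smooth cubic eightfold [crux rank 4 ConiveauLadderTransfer ⟹ crux
rank 3 MiddleCohomologySupportedInCodimThree, the node; = generalized Hodge conjecture in coniveau 3
for H⁸, known for general Y only: Shimada2003VanishingCyclesGHC §8, Terasoma1990]; (3) a rational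
(p+1,p+1)-class supported in codimension ≥ p is algebraic (Gysin images of desingularised supports
are polarisable sub-Hodge structures; semisimplicity; Lefschetz (1,1); Voisin2013GHCBloch Lemma
2.1), and off the middle degree H²ᵖ(Y) = ℂ·hᵖ (Lefschetz hyperplane theorem, VoisinHodgeII2003 Thm
1.23) [supports]. Assembly (PROVED in Sketch.lean, pure logic): GenericCubicEightfoldChowTwo →
CubicEightfoldChowZeroOne → ConiveauLadderTransfer → SubmaximalConiveauHodgeClassesAlgebraic →
HypersurfaceOffMiddleDegreesAlgebraic → CubicEightfoldHodgeModel → HodgeCubicEightfolds.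
Lean (one line; elaborates with imports Summits.HodgeConjecture.HodgeConjecture.Statement,
Literature.AlgebraicGeometry.Motives.Sweep1; lean check rc 0 on 2026-08-15): ∀ ⦃Y :
Literature.AlgebraicGeometry.Motives.SchemeOver ℂ⦄,
Literature.AlgebraicGeometry.Motives.IsSmoothHypersurface 8 3 Y →
Literature.AlgebraicGeometry.HodgeTheory.HodgeConjectureFor 8 Y

Rationale: WHY THIS LINE. Cubic eightfolds are the one hypersurface class where the coniveau ladder closes on
the Hodge conjecture itself: H⁸_prim has Hodge numbers (h⁵³,h⁴⁴,h³⁵) = (45,252,45) and h⁸⁰ = h⁷¹ =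
h⁶² = 0, so VoisinHodgeII2003 Thm 10.31 puts no obstruction on CH₀,CH₁,CH₂⊗ℚ ≅ ℚ, and k₀ = 2 = n/2 −
2 is exactly the rung at which the remainder correspondence Z′ ⊂ T×Y (codim T ≥ 3) pushes every
degree-8 class into N³H⁸, one step below algebraic (= N⁴H⁸), where Lefschetz (1,1) on a
desingularisation of T finishes. The Chow input appeared in 2024: Bai2024VoisinMaps Thm 3.6
(CH₁(F₁(Y))_ℚ ≅ ℚ for general Y ⊂ ℙ⁹; read arXiv:2404.10138 p.11) composed with Mboro2018 Thm 0.2 (=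
arXiv:1701.04488 Thm 2, read p.3: P_{1,*}: CH₁(F₁(Y)) → CH₂(Y) surjective for n ≥ 5) gives rank
CH₂(Y)_ℚ ≤ 1 for general cubic eightfolds — a corollary printed in neither paper (Mboro's own CH₂ =
ℤ needs n ≥ 9). The transfer generic ⇒ all members is a cycle-level specialisation (Fulton1998
§20.3, read pp.381-383; Voisin2015UniversalCodim2 Thm 2.1 is the CH₀ prototype), so Chow triviality
is needed only generically while the Hodge output lands on the special members where Hodge classes
live. Areas imported: Chow-theoretic decomposition of the diagonal (VoisinHodgeII2003 Ch. 10, read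
pp.263-266), specialisation of cycles (Fulton Ch. 20), Hodge theory of Gysin images
(GrothendieckTopology1969; tree file HodgeTheory/SupportedClassesHodgeConiveau). Catalogue: a
geometric/motivic lift (cycles on Y×Y control H⁸(Y)); no spectral, probabilistic or physical
reformulation is used.
RANKED CRUXES. rank 2 GenericCubicEightfoldChowTwo — the 2024 input (preprint risk; 'general' must
be matched with the coefficient-generic rendering by Aut(ℂ/ℚ)-transport). rank 3
MiddleCohomologySupportedInCodimThree — the node: supportedClasses Y 8 3 = ⊤ for EVERY smooth cubic
eightfold (GHC in coniveau 3 for H⁸; known for general Y by Shimada2003VanishingCyclesGHC §8, read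
p.22: all complete intersections with n ≤ 9, k = 3 for (9,(3)); and via Terasoma1990; open for
special Y; also directly attackable by cylinder maps). rank 4 ConiveauLadderTransfer — generic
rank-≤1 CH_{≤2} ⇒ the node for all Y (Thm 10.29 + spread + specialisation + correspondence action;
unpublished in this shaped form). Supports: CubicEightfoldChowZeroOne (ELV/Otwinowska via the
inversion formula, Mboro2018 p.3), SubmaximalConiveauHodgeClassesAlgebraic (Voisin2013GHCBloch proof
of Lemma 2.1, read p.6), HypersurfaceOffMiddleDegreesAlgebraic (VoisinHodgeII2003 Thm 1.23),
CubicEightfoldHodgeModel (tree fact nonempty_hodgeModel, not yet discharged), Assembly (proved in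
Sketch.lean; the node + supports already give the target, ranks 2 and 4 feed the node).
KILL CRITERIA. (a) A smooth cubic eightfold with a class of H⁸ not supported in codimension 3
refutes the node and closes the route (and refutes GHC). (b) A gap in Bai Thm 3.6 at n = 8 reopens
rank 2 but leaves ranks 3–4 alive (fallback input: Bai Thm B, eigenvalue −8 on CH₀(F₂(Y))_hom
against −2 on plane-swept 2-cycles, card §(ii′)). (c) If coefficient-genericity provably does not
imply Bai's 'general', restate rank 2 over a countable intersection of dense opens of the space of
cubics.
NOT DECOMPOSED YET. The shaped decomposition of Δ_Y as its own statement and the three-way split of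
rank 4 (generic Chow ⇒ decomposition at the generic member [Thm 10.29]; decomposition generic ⇒
decomposition for all members [spread + Fulton]; decomposition ⇒ N³H⁸ = H⁸ [needs an extra
CorrespondenceAction property 'Z ⊂ W′×W with dim W ≤ i acts by 0 on Hʳ, r > 2i', absent from the
tree's structure]) wait for rank 2 or a grounder; named facts to be filed by grounders (Bai 3.6,
Mboro 0.2, Thm 10.29, Prop 20.3); the card's next rungs ((2,3)-sixfolds, four quadrics, Fano
varieties of K3 type) are other routes.
NOVELTY and BARRIERS: see the header fields (searches: lit frontier / bridges HodgeConjecture; lit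
galaxy search "Hodge conjecture cubic eightfold", "cubic 8-fold" --star all; held texts read as
cited; plus the card's two refuter novelty audits over S2/zbMATH/arXiv).

Novelty: NOVELTY. Nearest prior art: Terasoma1990 (doi:10.1007/bf01444518) — HC for the GENERIC cubic 8-fold
via the fourfold of 3-planes and its cylinder map; Shimada2003VanishingCyclesGHC (arXiv:math/0311180
§8, read p.22) — codim-3 support of H₈ for GENERAL complete intersections in ℙⁿ, n ≤ 9;
Paranjape1994SmallChow / Laterveer1998 / VoisinHodgeII2003 Thm 10.29-10.31 (read pp.263-266) — the
ladder, used for Hodge-NUMBER vanishing; Voisin2015UniversalCodim2 Thm 2.1 — specialisation of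
CH₀-decompositions of the diagonal; Bai2024VoisinMaps (arXiv:2404.10138 Thm 3.6, read p.11) and
Mboro2018 (arXiv:1701.04488 Thm 2, read p.3) — the Chow inputs, neither mentioning CH₂ of eightfolds
or Hodge classes. DELTA: (i) the corollary rank CH₂(Y)_ℚ ≤ 1 for general cubic eightfolds (Bai ∘
Mboro) is printed nowhere; (ii) the ladder is run for Hodge CLASSES with output HC (p = k₀+2 meets
Lefschetz (1,1)), not Hodge numbers; (iii) the shaped decomposition is transported generic → every
smooth member, giving HC and GHC(coniveau 3, H⁸) for ALL smooth cubic eightfolds where print has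
general ones only. Expected grade: new-combination (card graded so by two audits). Searched
2026-08-15: lit frontier HodgeConjecture --since 2020; lit bridges HodgeConjecture --cross any; lit
galaxy search "Hodge conjecture cubic eightfold" / "cubic 8-fold" --star all (no further hit); also
read arXiv:1107.2600 p.6 (Lemma 2.1) and Fulton1998 pp.381-383; plus the card's two refuter audits
(S2, zbMATH, arXiv).  [refs: 10.1007/bf01444518, math/0311180, 2404.10138, 1701.04488, 1107.2600, doi:10.1007/bf01444518, Terasoma1990, Laterveer1998, VoisinHodgeII2003, Mboro2018, Fulton1998]

Barriers (technique_class: decomposition-of-the-diagonal, coniveau, chow-groups): BARRIERS (technique_class: decomposition-of-the-diagonal, coniveau, chow-groups; catalogue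
Literature/Barriers/HodgeConjecture, 19 entries checked).
- Literature.Barriers.HodgeConjecture.BlochSrinivas1983_hodgeTypeL0_vanish_of_chowZeroSupported: met
BY DESIGN — the ladder with k₀ = 2 forces h^{p,q} = 0 for q ≤ 2, p ≠ q, which holds for cubic
eightfolds (h⁸⁰ = h⁷¹ = h⁶² = 0); the barrier is the boundary of the method (it kills the same line
for cubic tenfolds, h⁷³ = 1), not an obstruction inside it.
- Literature.Barriers.HodgeConjecture.Grothendieck1969_generalHodgeConjecture_false: the node N³H⁸ =
H⁸ is Grothendieck's CORRECTED (support) form of GHC, in a case where F³H⁸ = H⁸ is trivially a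
sub-Hodge structure, so the level-versus-sub-Hodge-structure counterexample mechanism cannot occur.
- Literature.Barriers.HodgeConjecture.Clemens1983_griffithsGroup_infiniteRank: consistent — no
finite generation of cycle groups is used anywhere; rank CH₂⊗ℚ ≤ 1 on the eightfold coexists with
infinitely generated Griffiths groups of its hyperplane sections (cubic sevenfolds, h⁵² = 1).
- Literature.Barriers.HodgeConjecture.Voisin2003_generalHypersurface_noIntegralClassInF: evaded — no
Lefschetz pencil, normal function or Abel–Jacobi inversion; supports come from Chow triviality of
the generic member transported by specialisation of a cycle identity on Y×Y.
- Literature.Barriers.HodgeConjecture.AtiyahHirzebruch1962_torsionClass_notAlgebraic and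
Literature.Barriers.HodgeConjecture.Kollar1992_n

Novelty grade: new-combination — ROUTE REVIEW (refuter 2026-08-15): keep open, no crux blocked; full report REVIEW_R1_*.md + W1.lean attached as route evidence. All 9 decls rc0; Assembly re-proved sorry-free independently — layers compose as filed. Carriers real (ratTrivial via Scheme.ord; supportedClasses = ⨆ over closed Z of cohe (refuter refuter-rreview-route-HodgeConjecture-Co-9cfa3678-0, 2026-08-15T12:41:04Z; prior: arXiv:2404.10138 (Bai 2024, Thm 3.6 p.11, proof p.16; read), arXiv:1701.04488 (Mboro, Thm 2 p.3, Prop 1.4 p.8, Cor 2.9 p.12; read), doi:10.1215/kjm/1250518004 (Laterveer1998, small Chow groups => HC in degrees p<=r+2; cite-only acq-01562), doi:10.1007/bf01444518 (Terasoma1990, generic cubic 8-fold; zbl:0735.14006), arXiv:math/0311180 (Shimada2003 §8), VoisinHodgeII2003 Thm 10.29-10.31, Voisin2015U)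

History (route lifecycle, newest last):
- 2026-08-15T13:48:11Z · CLOSED retired — not-a-thesis: assembly does not conclude the sub-problem Statement (operator:999:1257524)

sub-problem: HodgeConjecture · status: closed(retired) · opened planner-plancard-HodgeConjecture-HodgeConject-da98b44c-0 2026-08-15T10:59:39Z · rev 2 · ledger route-HodgeConjecture-ConiveauLadderCubicEightfolds
GENERATED by the gate from the ledger (D-0016/17). Provers cite these decls: `theorem foo : Summit.HodgeConjecture.HodgeConjecture.Theses.ConiveauLadderCubicEightfolds.<Decl> := …` in Summits/HodgeConjecture/HodgeConjecture/Theorems/<Name>.lean.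
-/

namespace Summit.HodgeConjecture.HodgeConjecture.Theses.ConiveauLadderCubicEightfolds

open scoped BigOperators Topology Manifold Classical MeasureTheory ProbabilityTheory Matrix InnerProductSpace ComplexConjugate ContinuousMap
open Filter Set Function TopologicalSpace MeasureTheory

attribute [summit_statement] _root_.HodgeConjecture

/-- item stmt-HodgeConjecture-1907 · target · rank 0 · closed · moot by None · by planner
why it might fail: False iff some SPECIAL smooth cubic eightfold (Fermat-type, cyclic covers, positive-dimensional Hodge loci) carries a non-algebraic rational (4,4)-class in H⁸ (b₈ = 388); print covers only generic Y (Terasoma1990; Shimada2003 §8, n ≤ 9) and the Fermat cubic (Shioda1979, m = 3 prime).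
sources: Terasoma1990, Shimada2003VanishingCyclesGHC, §8 p.22 (arXiv:math/0311180), Shioda1979, Deligne2000, §1
[target] The Hodge conjecture for every smooth cubic eightfold Y ⊂ ℙ⁹_ℂ (all p; the content is p =
4: rational (4,4)-classes in H⁸(Y), b₈ = 1+45+252+45). An instance family of the summit:
HodgeConjecture → this is `fun h Y hY ↦ h hY.1` (Sketch.lean); the converse is not claimed. Generic
Y: Terasoma1990 (3-planes + cylinder map); all smooth Y: open in print. Thesis X of route
ConiveauLadderCubicEightfolds (card coniveau-ladder-cubic-eightfolds). -/
@[route_item "route-HodgeConjecture-ConiveauLadderCubicEightfolds"]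
def HodgeCubicEightfolds : Prop :=
  ∀ ⦃Y : Literature.AlgebraicGeometry.Motives.SchemeOver ℂ⦄, Literature.AlgebraicGeometry.Motives.IsSmoothHypersurface 8 3 Y → Literature.AlgebraicGeometry.HodgeTheory.HodgeConjectureFor 8 Y

/-- item stmt-HodgeConjecture-1908 · crux · rank 2 · closed · moot by None · by planner
why it might fail: Provable only via an unrefereed preprint: Bai Thm 3.6 (needs Y general: Lemma 3.14, strata R₁–R₃, Prop 3.25) ∘ Mboro Thm 0.2 (n=8: plane ⊂ Y, resolution in dim ≤ 2). Refereed print gives CH₂ = ℤ only for n ≥ 9 (Mboro Cor 0.6); ELV fails at l = 2. Plus 'general' ⇒ coefficient-generic transport.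
sources: Bai2024VoisinMaps, Thm 3.6 (arXiv:2404.10138 p.11; proof p.16) and Thm B (p.3), Mboro2018, Thm 0.2 and Cor 0.6 (= arXiv:1701.04488 Thm 2 p.3, Cor 6 p.4), EsnaultLevineViehweg1997, VoisinHodgeII2003, Thm 10.31 p.265 (h⁶² = 0: no Hodge obstruction)
[crux] For a smooth cubic eightfold Y = V(F) whose 220 coefficients are algebraically independent
over ℚ (a rigorous 'very general': every Aut(ℂ/ℚ)-invariant algebraic property holding on a dense
Zariski-open — or on a countable intersection of such — of the space of cubics holds for such F, by
transporting F with a field automorphism), any two 2-cycles c, c′ on Y satisfy a·c ~rat b·c′ with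
(a,b) ≠ (0,0), i.e. rank_ℚ CH₂(Y)⊗ℚ ≤ 1 (hence CH₂(Y)_ℚ = ℚ·[plane]). Route to it: Mboro2018 Thm 0.2
(= arXiv:1701.04488 Thm 2; n = 8 ≥ 2²+1, Y contains planes, resolution of singularities in dim ≤ 2):
the universal line P_{1,*}: CH₁(F₁(Y)) → CH₂(Y) is SURJECTIVE; Bai2024VoisinMaps Thm 3.6
(arXiv:2404.10138 p.11): CH₁(F₁(Y))_ℚ ≅ ℚ for a general cubic eightfold ('lines of lines', 3-planes
and cones). Independent cross-check (card §ii′): Bai Thm B (Voisin map Ψ_* = −8 on CH₀(F₂(Y))_hom)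
against ψ∘Ψ_* = −2ψ for the plane cylinder ψ, plus Mboro Cor 0.6 (planes generate CH₂ for n ≥ 7).
Bloch–Beilinson predicts the statement for ALL smooth cubic eightfolds (h⁶² = 0). -/
@[route_item "route-HodgeConjecture-ConiveauLadderCubicEightfolds"]
def GenericCubicEightfoldChowTwo : Prop :=
  ∀ ⦃Y : Literature.AlgebraicGeometry.Motives.SchemeOver ℂ⦄ (F : MvPolynomial (Fin (8 + 2)) ℂ), F.IsHomogeneous 3 → AlgebraicIndependent ℚ (fun m : {m : Fin (8 + 2) →₀ ℕ // m.degree = 3} => MvPolynomial.coeff m.1 F) → Literature.AlgebraicGeometry.Motives.IsSmoothHypersurface 8 3 Y → Literature.AlgebraicGeometry.Motives.IsHypersurfaceCutOutBy (8 + 1) F Y → ∀ c ∈ Literature.AlgebraicGeometry.Motives.cyclesOfDim Y.left 2, ∀ c' ∈ Literature.AlgebraicGeometry.Motives.cyclesOfDim Y.left 2, ∃ a b : ℤ, (a ≠ 0 ∨ b ≠ 0) ∧ Literature.AlgebraicGeometry.Motives.IsRationallyEquivalent (a • c) (b • c') 2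

/-- item stmt-HodgeConjecture-1909 · crux · rank 3 · closed · moot by None · by planner
why it might fail: = GHC (coniveau 3, H⁸) for EVERY smooth cubic 8-fold; printed proofs need Y general (Terasoma1990: F₃(Y) of expected dim 4 + cylinder map; Shimada2003 §8: general complete intersections, n ≤ 9). Special Y (Fermat-type, jumping F₃(Y), large Aut): nothing in print; false only if amended GHC fails.
sources: Shimada2003VanishingCyclesGHC, §8 p.22 (arXiv:math/0311180), Terasoma1990, GrothendieckTopology1969, p.300, VoisinHodgeII2003, proof of Thm 10.31 (pp.265-266)
[crux] THE NODE. For EVERY smooth cubic eightfold Y, every class of H⁸(Y(ℂ); ℂ) is supported on a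
Zariski-closed subset of codimension ≥ 3: supportedClasses Y 8 3 = ⊤, i.e. N³H⁸ = H⁸ —
Grothendieck's generalized Hodge conjecture in coniveau 3 for H⁸ (predicted because F³H⁸ = H⁸: h⁸⁰ =
h⁷¹ = h⁶² = 0). Known for GENERAL Y: Shimada2003VanishingCyclesGHC §8 (every element of H₈(Y,ℚ) is a
topological cycle supported in a codim-3 closed algebraic T, for all complete intersections in ℙⁿ
with n ≤ 9; (n,a) = (9,(3)) has k = 3), and via Terasoma1990's cylinder map from the fourfold of
3-planes. The route reaches it for ALL Y through ConiveauLadderTransfer (generic Chow triviality +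
specialisation); a direct proof for special Y (cylinder maps over possibly degenerate families of
3-planes, or vanishing-cycle arguments at symmetric members) would equally close the route, since
the Assembly needs only this node and the supports. Bonus: with
SubmaximalConiveauHodgeClassesAlgebraic it yields HC(Y). -/
@[route_item "route-HodgeConjecture-ConiveauLadderCubicEightfolds"]
def MiddleCohomologySupportedInCodimThree : Prop :=
  ∀ ⦃Y : Literature.AlgebraicGeometry.Motives.SchemeOver ℂ⦄, Literature.AlgebraicGeometry.Motives.IsSmoothHypersurface 8 3 Y → Literature.AlgebraicGeometry.HodgeTheory.supportedClasses Y 8 3 = ⊤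

/-- item stmt-HodgeConjecture-1910 · crux · rank 4 · closed · moot by None · by planner
why it might fail: Unpublished in this shaped form (k₀=0 prototype: Voisin2015 Thm 2.1). Load-bearing: cl-injectivity on CH_{≤2}⊗ℚ from rank ≤ 1 via cl(h^{8−i}) ≠ 0; descent of the data to a finite ext. of ℚ(B) + specialisation (Fulton 20.3) to ARBITRARY b ∈ B(ℂ); only [Z′]^* = pr₁∗(Z′·pr₂^*−) is T-supported.
sources: VoisinHodgeII2003, Thm 10.29 (pp.263-265, read) and proof of Thm 10.31 (pp.265-266, read), Fulton1998, §20.3 Prop 20.3 (pp.381-383), Voisin2015UniversalCodim2, Thm 2.1, Laterveer1998, Paranjape1994SmallChow, lean: Literature.AlgebraicGeometry.HodgeTheory.CorrespondenceAction.act_mem_supportedClasses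
[crux] THE MECHANISM (generic Chow ⇒ support for all members). Hypothesis (inlined) = rank_ℚ
CH_k(Y)⊗ℚ ≤ 1 for k ≤ 2 on coefficient-generic smooth cubic eightfolds (=
GenericCubicEightfoldChowTwo ∧ CubicEightfoldChowZeroOne); conclusion =
MiddleCohomologySupportedInCodimThree. Steps: (1) rank ≤ 1 plus a linear k-plane with non-zero class
⇒ cl injective on CH_{≤2}⊗ℚ of the generic member ⇒ VoisinHodgeII2003 Thm 10.29 (k₀ = 2): mΔ_Y =
Z₀+Z₁+Z₂+Z′ in CH⁸(Y×Y), m ≠ 0, Z_i ⊂ W′_i×W_i (dim W_i = i), Z′ ⊂ T×Y, codim T ≥ 3; (2) the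
coefficient-generic member is the geometric generic fibre of the universal family of cubics over ℚ̄,
so the identity (subvarieties and rational-equivalence data descend to a finite extension of the
function field) SPECIALISES to every smooth member along a DVR (Fulton1998 §20.3: σ[V] = [closure],
flat ⇒ dim W_i ≤ i, codim T ≥ 3 survive; Prop 20.3) — the shaped version of
Voisin2015UniversalCodim2 Thm 2.1; (3) act on H⁸(Y₀(ℂ);ℂ): [Δ]^* = id; [Z_i]^*α = Σ
n_ij⟨α,[W_ij]⟩[W′_ij] = 0 as deg α = 8 ≠ 2i; [Z′]^*α = τ_*[Z̃′]^*α is supported on T (tree: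
CorrespondenceAction.act_mem_supportedClasses); m ≠ 0, ℂ-coefficients ⇒ H⁸ = N³H⁸. -/
@[route_item "route-HodgeConjecture-ConiveauLadderCubicEightfolds"]
def ConiveauLadderTransfer : Prop :=
  (∀ ⦃Y : Literature.AlgebraicGeometry.Motives.SchemeOver ℂ⦄ (F : MvPolynomial (Fin (8 + 2)) ℂ), F.IsHomogeneous 3 → AlgebraicIndependent ℚ (fun m : {m : Fin (8 + 2) →₀ ℕ // m.degree = 3} => MvPolynomial.coeff m.1 F) → Literature.AlgebraicGeometry.Motives.IsSmoothHypersurface 8 3 Y → Literature.AlgebraicGeometry.Motives.IsHypersurfaceCutOutBy (8 + 1) F Y → ∀ k ≤ 2, ∀ c ∈ Literature.AlgebraicGeometry.Motives.cyclesOfDim Y.left k, ∀ c' ∈ Literature.AlgebraicGeometry.Motives.cyclesOfDim Y.left k, ∃ a b : ℤ, (a ≠ 0 ∨ b ≠ 0) ∧ Literature.AlgebraicGeometry.Motives.IsRationallyEquivalent (a • c) (b • c') k) → ∀ ⦃Y : Literature.AlgebraicGeometry.Motives.SchemeOver ℂ⦄, Literature.AlgebraicGeometry.Motives.IsSmoothHypersurface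 8 3 Y → Literature.AlgebraicGeometry.HodgeTheory.supportedClasses Y 8 3 = ⊤

/-- item stmt-HodgeConjecture-1911 · support · rank 5 · closed · moot by None · by planner
sources: Mboro2018, p.3 (= arXiv:1701.04488 p.3: inversion formula), EsnaultLevineViehweg1997, arXiv:1209.4342, VoisinHodgeII2003, Cor 10.28
[support] For every smooth cubic eightfold Y and k ∈ {0,1}, any two k-cycles have a non-trivial
integral relation modulo rational equivalence (rank_ℚ CH_k(Y)⊗ℚ ≤ 1). Known: CH₀(Y) = ℤ (Y is
unirational, hence rationally chain connected); CH₁(Y)_ℚ ≅ ℚ by the inversion formula 'X covered by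
ℙʳ's ⇒ CH_i(X)_ℚ ≅ ℚ for i < r' with r = 2 (recalled in Mboro2018 = arXiv:1701.04488 p.3, citing
EsnaultLevineViehweg1997 and Voisin's lectures; Otwinowska 1999; integrally Tian–Zong
arXiv:1209.4342 for 1-cycles) — a smooth cubic eightfold is covered by planes (planes through a
point x: zero scheme of 9 conditions on the 14-dimensional Grassmannian of planes through x,
non-empty of dimension ≥ 5; grounder to confirm the covering statement for EVERY smooth Y, else
restrict to general Y, which is all ConiveauLadderTransfer consumes). -/
@[route_item "route-HodgeConjecture-ConiveauLadderCubicEightfolds"]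
def CubicEightfoldChowZeroOne : Prop :=
  ∀ ⦃Y : Literature.AlgebraicGeometry.Motives.SchemeOver ℂ⦄, Literature.AlgebraicGeometry.Motives.IsSmoothHypersurface 8 3 Y → ∀ k ≤ 1, ∀ c ∈ Literature.AlgebraicGeometry.Motives.cyclesOfDim Y.left k, ∀ c' ∈ Literature.AlgebraicGeometry.Motives.cyclesOfDim Y.left k, ∃ a b : ℤ, (a ≠ 0 ∨ b ≠ 0) ∧ Literature.AlgebraicGeometry.Motives.IsRationallyEquivalent (a • c) (b • c') k

/-- item stmt-HodgeConjecture-1912 · support · rank 6 · closed · moot by None · by planner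
sources: Voisin2013GHCBloch, Lemma 2.1 and its proof, arXiv:1107.2600, GrothendieckTopology1969, p.300, VoisinHodgeII2003, proof of Prop 10.26 (p.306: the p = 1 case inside Bloch–Srinivas)
[support] On a smooth projective X/ℂ, a RATIONAL class of Hodge type (p+1,p+1) in H^{2p+2}(X(ℂ);ℂ)
that is supported in codimension ≥ p (∈ Nᵖ H^{2p+2} = supportedClasses X (2(p+1)) p) is algebraic. p
= 0 is Lefschetz (1,1) itself (tree fact HodgeTheory.lefschetzOneOne_rational); general p: Nᵖ
H^{2p+2}(X,ℚ) = Σ_T Im(τ_*: H²(T̃,ℚ)(−p) → H^{2p+2}(X,ℚ)) over desingularisations T̃ of the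
codimension-p components of the supports (Deligne's strictness; GrothendieckTopology1969 p.300), ⊕_T
H²(T̃) → Nᵖ is a surjection of polarisable ℚ-Hodge structures, so a Hodge class of the image lifts
to Hodge classes β_T ∈ Hdg²(T̃) (semisimplicity), which are ℚ-divisor classes (Lefschetz (1,1));
push the divisors forward. In print: Voisin2013GHCBloch, proof of Lemma 2.1 (read arXiv:1107.2600
p.6), with Voisin's Torino lectures for the lifting step. Used at (n,p) = (8,3). -/
@[route_item "route-HodgeConjecture-ConiveauLadderCubicEightfolds"]
def SubmaximalConiveauHodgeClassesAlgebraic : Prop :=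
  ∀ ⦃n : ℕ⦄ ⦃X : Literature.AlgebraicGeometry.Motives.SchemeOver ℂ⦄, Literature.AlgebraicGeometry.Motives.IsSmoothProjective n X → ∀ (p : ℕ) (c : Literature.AlgebraicGeometry.HodgeTheory.complexBetti X (2 * (p + 1))), c ∈ Literature.AlgebraicGeometry.HodgeTheory.supportedClasses X (2 * (p + 1)) p → Literature.AlgebraicGeometry.HodgeTheory.IsRationalClass c → Literature.AlgebraicGeometry.HodgeTheory.IsOfHodgeType n X (2 * (p + 1)) (p + 1) (p + 1) c → c ∈ Literature.AlgebraicGeometry.HodgeTheory.algebraicClasses X (p + 1)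

/-- item stmt-HodgeConjecture-1913 · support · rank 7 · closed · moot by None · by planner
sources: VoisinHodgeII2003, Thm 1.23 (p.60), VoisinHodgeI2002, §11.3, Deligne2000, §1
[support] For a smooth hypersurface Y ⊂ ℙ^{n+1}_ℂ of dimension n (any degree) and 2p ≠ n:
algebraicClasses Y p = ⊤, because H^{2p}(Y(ℂ);ℂ) = ℂ·hᵖ (Lefschetz hyperplane theorem
VoisinHodgeII2003 Thm 1.23 applied to the Veronese re-embedding for 2p < n; Poincaré duality and hⁿ
= d·[pt] ≠ 0 for n < 2p ≤ 2n; zero above 2n) and hᵖ is the class of a codimension-p linear section.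
Classical: for a smooth hypersurface only p = n/2 is non-trivial in HC (Shioda 1983 §2 (4), quoted
in the tree's Motives/Sweep1 docstring). -/
@[route_item "route-HodgeConjecture-ConiveauLadderCubicEightfolds"]
def HypersurfaceOffMiddleDegreesAlgebraic : Prop :=
  ∀ ⦃n d : ℕ⦄ ⦃Y : Literature.AlgebraicGeometry.Motives.SchemeOver ℂ⦄, Literature.AlgebraicGeometry.Motives.IsSmoothHypersurface n d Y → ∀ p : ℕ, 2 * p ≠ n → Literature.AlgebraicGeometry.HodgeTheory.algebraicClasses Y p = ⊤

/-- item stmt-HodgeConjecture-1914 · support · rank 8 · closed · moot by None · by planner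
sources: VoisinHodgeI2002, Thm 6.18 and §6.1.3, SerreGAGA1956, §2, lean: Literature.AlgebraicGeometry.HodgeTheory.nonempty_hodgeModel (HodgeTheory/HodgeModelExistence.lean:75)
[support] Every smooth cubic eightfold has a Hodge model (analytification + natural de Rham
comparison + Hodge decomposition): the tree's named fact HodgeTheory.nonempty_hodgeModel 8 Y
(HodgeTheory/HodgeModelExistence.lean; reductions in HodgeModelExistenceProofs /
HodgeModelExistenceDischarge) specialised to hypersurfaces. Needed only for the anti-vacuity
conjunct of HodgeConjectureFor 8 Y; closes the moment the fact is discharged (one line from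
nonempty_hodgeModel applied to hY.1). -/
@[route_item "route-HodgeConjecture-ConiveauLadderCubicEightfolds"]
def CubicEightfoldHodgeModel : Prop :=
  ∀ ⦃Y : Literature.AlgebraicGeometry.Motives.SchemeOver ℂ⦄, Literature.AlgebraicGeometry.Motives.IsSmoothHypersurface 8 3 Y → Nonempty (Literature.AlgebraicGeometry.HodgeTheory.HodgeModel 8 Y)

/-- item stmt-HodgeConjecture-2192 · support · rank 9 · closed · moot by None · by planner
sources: VoisinHodgeII2003, Thm 10.29 and proof of Thm 10.31 (pp.263-266), Paranjape1994SmallChow, Laterveer1998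
[support] The per-variety rung of the ladder, with NO transfer: a smooth projective EIGHTFOLD X/ℂ
whose CH₀, CH₁, CH₂ ⊗ ℚ all have rank ≤ 1 (pairwise proportional cycles modulo rational equivalence)
has every class of H⁸(X(ℂ);ℂ) supported in codimension ≥ 3 (supportedClasses X 8 3 = ⊤). Proof
pattern: rank ≤ 1 ⇒ cl injective on CH_{≤2}⊗ℚ (the class of any non-torsion generator is non-zero,
else all classes vanish while hᵏ-sections do not) ⇒ VoisinHodgeII2003 Thm 10.29 (k₀ = 2): mΔ_X =
Z₀+Z₁+Z₂+Z′, Z_i ⊂ W′_i×W_i (dim W_i = i), Z′ ⊂ T×X, codim T ≥ 3; act on H⁸: [Z_i]^* = 0 (degree 8 ≠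
2i), [Z′]^*α supported on T (proof of Thm 10.31, p.266; tree
CorrespondenceAction.act_mem_supportedClasses). It is the k₀ = 2, n = 8 sibling of LadderHodgeSix in
route SchlafliMinusFive (k₀ = 1, n = 6) and the transfer-free half of ConiveauLadderTransfer (the
other half: the shaped decomposition, not the Chow rank, specialises from the generic cubic to every
member). Sources: VoisinHodgeII2003 Thm 10.29/10.31; Paranjape1994SmallChow; Laterveer1998. -/
@[route_item "route-HodgeConjecture-ConiveauLadderCubicEightfolds"]
def LadderSupportEightfold : Prop :=
  ∀ ⦃X : Literature.AlgebraicGeometry.Motives.SchemeOver ℂ⦄, Literature.AlgebraicGeometry.Motives.IsSmoothProjective 8 X → (∀ k ≤ 2, ∀ c ∈ Literature.AlgebraicGeometry.Motives.cyclesOfDim X.left k, ∀ c' ∈ Literature.AlgebraicGeometry.Motives.cyclesOfDim X.left k, ∃ a b : ℤ, (a ≠ 0 ∨ b ≠ 0) ∧ Literature.AlgebraicGeometry.Motives.IsRationallyEquivalent (a • c) (b • c') k) → Literature.AlgebraicGeometry.HodgeTheory.supportedClasses X 8 3 = ⊤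

/-- item stmt-HodgeConjecture-1915 · assembly · rank 1 · closed · moot by None · by planner
sources: Deligne2000, §1, VoisinHodgeII2003, proof of Thm 10.31
[assembly] Pure logic — PROVED in the planner's Sketch.lean (theorem assembly_holds, lean check rc
0, 2026-08-15; a prover may copy its 15 lines): from rank-≤1 CH₂ (generic) and CH₀, CH₁ (all Y)
build the inlined hypothesis of ConiveauLadderTransfer (case split k = 2 / k ≤ 1) and get
supportedClasses Y 8 3 = ⊤ for every smooth cubic eightfold; for a rational (p,p)-class c: if 2p = 8
apply SubmaximalConiveauHodgeClassesAlgebraic at (n,p) = (8,3) (2·(3+1) = 8 and c ∈ ⊤ are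
definitional), if 2p ≠ 8 use HypersurfaceOffMiddleDegreesAlgebraic (algebraicClasses = ⊤);
CubicEightfoldHodgeModel supplies the Hodge-model conjunct of HodgeConjectureFor 8 Y. The node
MiddleCohomologySupportedInCodimThree proved directly also discharges the ConiveauLadderTransfer
premise trivially. -/
@[route_item "route-HodgeConjecture-ConiveauLadderCubicEightfolds"]
def Assembly : Prop :=
  GenericCubicEightfoldChowTwo → CubicEightfoldChowZeroOne → ConiveauLadderTransfer → SubmaximalConiveauHodgeClassesAlgebraic → HypersurfaceOffMiddleDegreesAlgebraic → CubicEightfoldHodgeModel → HodgeCubicEightfolds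

end Summit.HodgeConjecture.HodgeConjecture.Theses.ConiveauLadderCubicEightfolds
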